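import Literature.NumberTheory.Sieve.ParityWave0MPZProofs
import Literature.NumberTheory.Sieve.ParityWave0MPZDenseDivisibility
import HarnessLib

/-!
# parity.S29 — Polymath 8a, Claim 2.3 `MPZ^{(i)}[ϖ, δ]` and its passage to the vendored `MPZ`

Topic `Literature/NumberTheory/Sieve`; a sibling file of `ParityWave0.lean` serving the named fact
`Literature.NumberTheory.Sieve.mpz_of_lt` (**parity.S29**: `MPZ[ϖ, δ]` whenever `ϖ, δ > 0` and
`600ϖ + 180δ < 7`).  What D. H. J. Polymath, *New equidistribution estimates of Zhang type*, Algebra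
Number Theory 8 (2014) 2067–2199 = arXiv:1402.0811, actually proves as Theorem 2.4(i) is
**Claim 2.3**, the *modified* Motohashi–Pintz–Zhang estimate `MPZ^{(4)}[ϖ, δ]`, whose moduli are the
squarefree `q ≤ Q ⪅ x^{1/2+2ϖ}` with prime factors in an arbitrary bounded set `I` and which are
`i`-tuply `x^δ`-densely divisible (Definition 2.1, the tree's `DenselyDivisible`), the discrepancy being
measured against the coprime mean.  This file vendors Claim 2.3 as the parametrised predicate
`Literature.NumberTheory.Sieve.MPZi i ϖ δ` (vocabulary — the hypothesis/conclusion of Theorem 2.4,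
Lemma 2.7 and the Type I/II/III estimates; no claim is asserted) and PROVES the passage displayed
after Theorem 2.4:

* `MPZi.anti_index` — "the statement `MPZ^{(i)}[ϖ, δ]` is easier to establish as `i` increases"
  (Lemma 2.10 (0));
* `MPZi.mono` — monotonicity in the level exponent `ϖ`;
* `MPZ.of_mpzi` — `MPZ^{(i)}[ϖ, δ]` for some `i` implies the vendored smooth-moduli `MPZ ϖ δ`
  (`0 ≤ δ`, `ϖ ≤ 1/4`): smooth squarefree moduli are `i`-tuply densely divisible (Lemma 2.10 (iii),
  `DenselyDivisible.of_mem_smoothNumbers`) with prime factors in `I = {p ≤ x^δ}`, and the coprime-mean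
  main term is interchangeable with `x/φ(q)` (`MPZ_iff_coprimeMean`);
* `mpz_of_lt_of_mpzi_four` — **Theorem 2.4(i) as printed implies parity.S29**: if
  `MPZ^{(4)}[ϖ, δ]` holds for all `ϖ, δ > 0` with `600ϖ + 180δ < 7`, then `mpz_of_lt`.  This pins
  the vendored named fact to the precise printed claim; the hypothesis is NOT asserted here (its proof
  is Polymath 8a §§3–8 with Deligne's theorems, absent from the tree);
* `mpzi_of_neg` — non-vacuity: `MPZ^{(i)}[ϖ, δ]` holds for every `ϖ < 0` (the Bombieri–Vinogradov
  range, from the tree's `bombieri_vinogradov_holds`, through a version of the Bombieri–Vinogradov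
  bound over arbitrary finite sets of moduli below `x^θ`, `θ < 1/2`,
  `MPZi.sum_abs_sub_le_of_bombieri_vinogradov`).

## Rendering of Claim 2.3 (faithfulness notes)

"Let `I ⊂ ℝ` be a bounded set, which may vary with `x`, and let `Q ⪅ x^{1/2+2ϖ}`. If `a` is an
integer coprime to `P_I`, and `A ≥ 1` is fixed, then
`∑_{q ≤ Q, q ∈ D_I^{(i)}(x^δ)} |Δ(Λ 1_{[x,2x]}; a (q))| ≪ x log^{-A} x`", with (§1.3)
`Δ(α; a (q)) = ∑_{n = a (q)} α(n) − (1/φ(q)) ∑_{(n,q)=1} α(n)` and (the display in Definition 2.1,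
with Definition 2.2) `D_I^{(i)}(y) = S_I ∩ D^{(i)}(y)`, `S_I` the squarefree numbers with all prime
factors in `I`.
(a) Only the primes of `I` matter, so `I` is a `Finset ℕ` of primes; `a` coprime to `P_I` is
"no `p ∈ I` divides `a`". (b) "`Q ⪅ x^{1/2+2ϖ}`" (i.e. `Q ≤ x^{1/2+2ϖ+o(1)}`) with "`≪_A`" is
rendered as: for every `A` there are `ε > 0` and `C` such that the bound `C x (log x)^{-A}` holds for
all moduli sets below `x^{1/2+2ϖ+ε}` — equivalent to the printed asymptotic form by the usual
diagonal argument (a failure for every `ε = 1/n`, `C = n` produces `x_n → ∞` and `Q(x_n) = x_n^{1/2+2ϖ+o(1)}`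
violating the claim). (c) The sum over `{q ≤ Q} ∩ D_I^{(i)}(x^δ)` is rendered as a bound for
`∑_{q ∈ S}` over every finite set `S` of admissible moduli (all terms are nonnegative, so this is the
same statement and needs no decidability of `DenselyDivisible`). (d) The interval `(x, 2x]` replaces
`[x, 2x]` (the tree's `ψ(2x; q, a) − ψ(x; q, a)`); the endpoint `n = x` contributes at most `log x`
per modulus dividing `x − a`, which is admissible. (e) "for all sufficiently large `x`" is `∀ x ≥ 2`
(bounded ranges are trivial, uniformly in `I, a, S`). The constant is uniform in `I`, `a` and `S`, as
in print (Theorem 1.1: "independent of the residue classes").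

## References

* D. H. J. Polymath, *New equidistribution estimates of Zhang type*, Algebra Number Theory 8 (2014),
  2067–2199, arXiv:1402.0811: §1.3 (discrepancy), Definitions 2.1–2.2, Claim 2.3, Theorem 2.4 and
  the display after it, Lemma 2.10. [cite: Polymath8a2014]
-/

open Finset
open scoped ArithmeticFunction.vonMangoldt

namespace Literature.NumberTheory.Sieve

/-- **Polymath 8a, Claim 2.3 — the modified Motohashi–Pintz–Zhang estimate `MPZ^{(i)}[ϖ, δ]`**:
"Let `I ⊂ ℝ` be a bounded set, which may vary with `x`, and let `Q ⪅ x^{1/2+2ϖ}`. If `a` is an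
integer coprime to `P_I`, and `A ≥ 1` is fixed, then
`∑_{q ≤ Q, q ∈ D_I^{(i)}(x^δ)} |Δ(Λ 1_{[x,2x]}; a (q))| ≪ x log^{-A} x`."  Rendered (see the module
docstring for the conventions): for every `A` there are `ε > 0` and `C` such that for all `x ≥ 2`,
every finite set `I` of primes, every integer `a` divisible by no prime of `I`, and every finite set
`S` of squarefree moduli `q ≤ x^{1/2+2ϖ+ε}` with all prime factors in `I` and `i`-tuply
`x^δ`-densely divisible (`DenselyDivisible (x^δ) i q`, Definition 2.1),
`∑_{q ∈ S} |ψ(2x; q, a) − ψ(x; q, a) − (1/φ(q)) ∑_{x < n ≤ 2x, (n,q)=1} Λ(n)| ≤ C x (log x)^{-A}`.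
A parametrised predicate (the common currency of Theorem 2.4, Lemma 2.7 and Theorem 2.8), not a
claim. [cite: Polymath8a2014, Claim 2.3] -/
def MPZi (i : ℕ) (ϖ δ : ℝ) : Prop :=
  ∀ A : ℝ, ∃ ε : ℝ, 0 < ε ∧ ∃ C : ℝ, ∀ x : ℝ, 2 ≤ x → ∀ I : Finset ℕ, (∀ p ∈ I, p.Prime) →
    ∀ a : ℤ, (∀ p ∈ I, ¬(p : ℤ) ∣ a) →
    ∀ S : Finset ℕ, (∀ q ∈ S, (q : ℝ) ≤ x ^ (1 / 2 + 2 * ϖ + ε) ∧ Squarefree q ∧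
        q.primeFactors ⊆ I ∧ DenselyDivisible (x ^ δ) i q) →
    ∑ q ∈ S, |ParityWave0.chebyshevPsiMod q (a : ZMod q) (2 * x) -
        ParityWave0.chebyshevPsiMod q (a : ZMod q) x -
        ((∑ n ∈ range (⌊2 * x⌋₊ + 1) with n.Coprime q, Λ n) -
          ∑ n ∈ range (⌊x⌋₊ + 1) with n.Coprime q, Λ n) / Nat.totient q| ≤
      C * x / Real.log x ^ A

/-- **"The statement `MPZ^{(i)}[ϖ, δ]` is easier to establish as `i` increases"** (Polymath 8a,
after Theorem 2.4): `MPZ^{(i)} ⟹ MPZ^{(i')}` for `i ≤ i'`, since an `i'`-tuply densely divisible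
modulus is `i`-tuply densely divisible (Lemma 2.10 (0), `DenselyDivisible.anti`), so the admissible
sets of moduli only shrink. [cite: Polymath8a2014, remark after Theorem 2.4 and Lemma 2.10 (0)] -/
theorem MPZi.anti_index {i i' : ℕ} {ϖ δ : ℝ} (h : MPZi i ϖ δ) (hii : i ≤ i') : MPZi i' ϖ δ := by
  intro A
  obtain ⟨ε, hε, C, hC⟩ := h A
  refine ⟨ε, hε, C, fun x hx I hI a ha S hS => hC x hx I hI a ha S fun q hq => ?_⟩
  obtain ⟨h1, h2, h3, h4⟩ := hS q hq
  exact ⟨h1, h2, h3, h4.anti hii⟩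

/-- `MPZ^{(i)}[ϖ, δ]` is downward monotone in the level exponent `ϖ` (a smaller level admits fewer
moduli; `x ≥ 2`). [cite: Polymath8a2014, Claim 2.3] -/
theorem MPZi.mono {i : ℕ} {ϖ ϖ' δ : ℝ} (h : MPZi i ϖ δ) (hϖ : ϖ' ≤ ϖ) : MPZi i ϖ' δ := by
  intro A
  obtain ⟨ε, hε, C, hC⟩ := h A
  refine ⟨ε, hε, C, fun x hx I hI a ha S hS => hC x hx I hI a ha S fun q hq => ?_⟩
  obtain ⟨h1, h2, h3, h4⟩ := hS q hq
  exact ⟨h1.trans (Real.rpow_le_rpow_of_exponent_le (by linarith) (by linarith)), h2, h3, h4⟩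

/-- **`MPZ^{(i)}[ϖ, δ]` implies the vendored smooth-moduli `MPZ[ϖ, δ]`** (Polymath 8a, the display
after Theorem 2.4: "If true for some `i ≥ 1`, it implies
`∑_{q ≤ x^{1/2+2ϖ−ε}, q x^δ-smooth, squarefree} |Δ(Λ 1_{[x,2x]}; a (q))| ≪ x log^{-A} x`"), for
`0 ≤ δ` and `ϖ ≤ 1/4`: take `I` the primes `≤ x^δ` and `S` the squarefree `x^δ`-smooth `q ≤ x^{1/2+2ϖ}`
— each is `i`-tuply `x^δ`-densely divisible by Lemma 2.10 (iii) (`DenselyDivisible.of_mem_smoothNumbers`)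
and below `x^{1/2+2ϖ+ε}` — and pass from the coprime mean to `x/φ(q)` by `MPZ_iff_coprimeMean`.
(No `ε`-loss in the level is needed here because the rendering of "`Q ⪅`" already grants a level
`x^{1/2+2ϖ+ε}`.) [cite: Polymath8a2014, display after Theorem 2.4, Lemma 2.10 (iii)] -/
theorem MPZ.of_mpzi {i : ℕ} {ϖ δ : ℝ} (h : MPZi i ϖ δ) (hϖ : ϖ ≤ 1 / 4) (hδ : 0 ≤ δ) :
    MPZ ϖ δ := by
  rw [MPZ_iff_coprimeMean hϖ]
  intro A
  obtain ⟨ε, hε, C, hC⟩ := h A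
  refine ⟨C, fun x hx a ha => ?_⟩
  have hx1 : 1 ≤ x := by linarith
  -- the primes `≤ x^δ`
  set I : Finset ℕ := (Finset.range (⌊x ^ δ⌋₊ + 1)).filter Nat.Prime with hI
  have hIp : ∀ p ∈ I, p.Prime := fun p hp => (Finset.mem_filter.mp hp).2
  have haI : ∀ p ∈ I, ¬(p : ℤ) ∣ a := fun p hp =>
    ha p (Finset.mem_filter.mp hp).2 (Nat.lt_succ_iff.mp (Finset.mem_range.mp (Finset.mem_filter.mp hp).1))
  refine hC x hx I hIp a haI _ fun q hq => ?_
  obtain ⟨hqI, hsq, hsm⟩ := Finset.mem_filter.mp hq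
  refine ⟨?_, hsq, ?_, ?_⟩
  · calc (q : ℝ) ≤ ⌊x ^ (1 / 2 + 2 * ϖ)⌋₊ := by exact_mod_cast (Finset.mem_Icc.mp hqI).2
      _ ≤ x ^ (1 / 2 + 2 * ϖ) := Nat.floor_le (Real.rpow_nonneg (by linarith) _)
      _ ≤ x ^ (1 / 2 + 2 * ϖ + ε) := Real.rpow_le_rpow_of_exponent_le hx1 (by linarith)
  · intro p hp
    have hp' := Nat.mem_primeFactors.mp hp
    exact Finset.mem_filter.mpr
      ⟨Finset.mem_range.mpr ((Nat.mem_smoothNumbers'.mp hsm) p hp'.1 hp'.2.1), hp'.1⟩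
  · exact DenselyDivisible.of_mem_smoothNumbers (Real.one_le_rpow hx1 hδ) hsm i

/-- **Theorem 2.4(i) of Polymath 8a, as printed, implies parity.S29**: if `MPZ^{(4)}[ϖ, δ]`
(Claim 2.3 with quadruple dense divisibility) holds for all `ϖ, δ > 0` with `600ϖ + 180δ < 7` —
Theorem 2.4(i): "We have `MPZ^{(4)}[ϖ, δ]` for any fixed `ϖ, δ > 0` such that `600ϖ + 180δ < 7`"
— then the vendored named fact `mpz_of_lt` holds (`MPZ.of_mpzi`; `600ϖ < 7` gives `ϖ ≤ 1/4`).  The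
hypothesis is the printed theorem itself and is NOT proved in the tree (Polymath 8a §§3–8: Heath-Brown
identity, dispersion, Weil's and Deligne's bounds); this theorem only pins the vendored statement to
it. [cite: Polymath8a2014, Theorem 2.4(i) and the display after it] -/
theorem mpz_of_lt_of_mpzi_four
    (h : ∀ ϖ δ : ℝ, 0 < ϖ → 0 < δ → 600 * ϖ + 180 * δ < 7 → MPZi 4 ϖ δ) : mpz_of_lt :=
  fun ϖ δ hϖ hδ hlt => MPZ.of_mpzi (h ϖ δ hϖ hδ hlt) (by linarith) hδ.le

/-- The same from `MPZ^{(i)}` of any fixed order `i` (e.g. `i = 1`, plain dense divisibility, or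
`i = 2` as in the Deligne-free Theorem 2.4(ii) on its own range): if `MPZ^{(i)}[ϖ, δ]` holds on the
region `600ϖ + 180δ < 7`, then `mpz_of_lt`. [cite: Polymath8a2014, Theorem 2.4 and the display after it] -/
theorem mpz_of_lt_of_mpzi (i : ℕ)
    (h : ∀ ϖ δ : ℝ, 0 < ϖ → 0 < δ → 600 * ϖ + 180 * δ < 7 → MPZi i ϖ δ) : mpz_of_lt :=
  fun ϖ δ hϖ hδ hlt => MPZ.of_mpzi (h ϖ δ hϖ hδ hlt) (by linarith) hδ.le

/-! ### Non-vacuity: `MPZ^{(i)}[ϖ, δ]` in the Bombieri–Vinogradov range `ϖ < 0` -/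

/-- If the prime factors of `q ≠ 0` lie in `I` and no prime of `I` divides `a`, then `(a, q) = 1`.
[folklore] -/
theorem MPZi.isCoprime_of_primeFactors_subset {a : ℤ} {I : Finset ℕ} {q : ℕ} (hq : q ≠ 0)
    (ha : ∀ p ∈ I, ¬(p : ℤ) ∣ a) (hI : q.primeFactors ⊆ I) : IsCoprime a (q : ℤ) := by
  have hqa : Nat.Coprime q a.natAbs := by
    refine Nat.coprime_of_dvd fun p hp hpq hpa => ?_
    have hpI : p ∈ I := hI (Nat.mem_primeFactors.mpr ⟨hp, hpq, hq⟩)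
    exact ha p hpI (Int.natCast_dvd.mpr hpa)
  rw [Int.isCoprime_iff_nat_coprime, Int.natAbs_natCast]
  exact hqa.symm

/-- **Bombieri–Vinogradov over an arbitrary set of moduli below `x^θ`, `θ < 1/2`** (the engine of
`MPZ.bound_of_bombieri_vinogradov`, now for any finite set `S` of moduli `q ≤ x^θ` coprime to `a`):
for `0 ≤ θ < 1/2` and `A ≥ 0` there is `C` with
`∑_{q ∈ S} |ψ(2x; q, a) − ψ(x; q, a) − x/φ(q)| ≤ C x (log x)^{-A}` for all `x ≥ 2`.  Same proof:
each summand is at most the sum of the two Bombieri–Vinogradov maxima at `2x` and at `x`, the level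
`x^θ` is eventually below `x^{1/2}(log x)^{-B}` and `(2x)^{1/2}(log 2x)^{-B}`, and bounded `x` are
trivial (`MPZ.abs_summand_le`).  (The input is the classical Bombieri–Vinogradov theorem, parity.S27;
Polymath 8a's Theorem 2.9 is its bilinear generalisation, not used here.) [cite: Bombieri1965] -/
theorem MPZi.sum_abs_sub_le_of_bombieri_vinogradov (hBV : bombieri_vinogradov) {θ : ℝ}
    (hθ0 : 0 ≤ θ) (hθ : θ < 1 / 2) {A : ℝ} (hA : 0 ≤ A) :
    ∃ C : ℝ, ∀ x : ℝ, 2 ≤ x → ∀ a : ℤ, ∀ S : Finset ℕ,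
      (∀ q ∈ S, q ≠ 0 ∧ (q : ℝ) ≤ x ^ θ ∧ IsCoprime a (q : ℤ)) →
      ∑ q ∈ S, |ParityWave0.chebyshevPsiMod q (a : ZMod q) (2 * x) -
          ParityWave0.chebyshevPsiMod q (a : ZMod q) x - x / Nat.totient q| ≤
        C * x / Real.log x ^ A := by
  -- write `θ = 1/2 + 2ϖ` with `-1/4 ≤ ϖ < 0`
  set ϖ : ℝ := (θ - 1 / 2) / 2 with hϖ
  have hθϖ : θ = 1 / 2 + 2 * ϖ := by rw [hϖ]; ring
  have hϖ0 : ϖ < 0 := by rw [hϖ]; linarith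
  obtain ⟨B, C, hBC⟩ := hBV A
  have h2x : Filter.Tendsto (fun x : ℝ => 2 * x) Filter.atTop Filter.atTop :=
    Filter.tendsto_id.const_mul_atTop two_pos
  have hlo : ∀ᶠ x : ℝ in Filter.atTop, ‖Real.log x ^ B‖ ≤ ‖x ^ (-(2 * ϖ))‖ :=
    (isLittleO_log_rpow_rpow_atTop B (by linarith : 0 < -(2 * ϖ))).eventuallyLE
  obtain ⟨x₀, hx₀⟩ := Filter.eventually_atTop.mp
    (hBC.and ((h2x.eventually hBC).and (hlo.and (h2x.eventually hlo))))
  set x₁ : ℝ := max x₀ 2 with hx₁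
  have hx₁2 : 2 ≤ x₁ := le_max_right _ _
  have hL₁ : 0 < Real.log x₁ ^ A := Real.rpow_pos_of_pos (Real.log_pos (by linarith)) A
  refine ⟨max (15 * x₁ * Real.log x₁ ^ A) (3 * |C|), fun x hx a S hS => ?_⟩
  have hx0 : 0 < x := by linarith
  have hx1 : 1 ≤ x := by linarith
  have hlogx : 0 < Real.log x := Real.log_pos (by linarith)
  have hLA : 0 < Real.log x ^ A := Real.rpow_pos_of_pos hlogx A
  -- `S ⊆ [1, ⌊x^θ⌋]`
  have hSsub : S ⊆ Finset.Icc 1 ⌊x ^ θ⌋₊ := fun q hq => by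
    obtain ⟨hq0, hqx, -⟩ := hS q hq
    exact Finset.mem_Icc.mpr ⟨Nat.one_le_iff_ne_zero.mpr hq0, Nat.le_floor hqx⟩
  have hQx : (⌊x ^ θ⌋₊ : ℝ) ≤ x := by
    refine (Nat.floor_le (Real.rpow_nonneg hx0.le _)).trans ?_
    calc x ^ θ ≤ x ^ (1 : ℝ) := Real.rpow_le_rpow_of_exponent_le hx1 (by linarith)
      _ = x := Real.rpow_one x
  rcases le_or_gt x x₁ with hsmall | hlarge
  · /- small `x` -/
    calc ∑ q ∈ S, |ParityWave0.chebyshevPsiMod q (a : ZMod q) (2 * x) -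
            ParityWave0.chebyshevPsiMod q (a : ZMod q) x - x / Nat.totient q|
        ≤ ∑ q ∈ S, 15 * x := Finset.sum_le_sum fun q hq =>
            MPZ.abs_summand_le (Nat.one_le_iff_ne_zero.mpr (hS q hq).1) _ hx0.le
      _ = #S * (15 * x) := by rw [Finset.sum_const, nsmul_eq_mul]
      _ ≤ (⌊x ^ θ⌋₊ : ℝ) * (15 * x) := by
          refine mul_le_mul_of_nonneg_right ?_ (by linarith)
          have := Finset.card_le_card hSsub
          rw [Nat.card_Icc, Nat.add_sub_cancel] at this
          exact_mod_cast this
      _ ≤ x₁ * (15 * x) := mul_le_mul_of_nonneg_right (hQx.trans hsmall) (by linarith)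
      _ = 15 * x₁ * Real.log x₁ ^ A * x / Real.log x₁ ^ A := by field_simp
      _ ≤ 15 * x₁ * Real.log x₁ ^ A * x / Real.log x ^ A :=
          div_le_div_of_nonneg_left (by positivity) hLA
            (Real.rpow_le_rpow hlogx.le (Real.log_le_log hx0 hsmall) hA)
      _ ≤ max (15 * x₁ * Real.log x₁ ^ A) (3 * |C|) * x / Real.log x ^ A :=
          div_le_div_of_nonneg_right (mul_le_mul_of_nonneg_right (le_max_left _ _) hx0.le) hLA.le
  · /- large `x` -/
    obtain ⟨hBVx, hBV2x, hlox, hlo2x⟩ := hx₀ x ((le_max_left _ _).trans hlarge.le)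
    have h1 : ∑ q ∈ Icc 1 ⌊x ^ (1 / 2 : ℝ) / Real.log x ^ B⌋₊,
        (⨆ b : (ZMod q)ˣ, |ParityWave0.chebyshevPsiMod q b x - x / Nat.totient q|) ≤
          C * x / Real.log x ^ A :=
      hBVx (fun _ => x) fun _ => ⟨by linarith, le_rfl⟩
    have h2 : ∑ q ∈ Icc 1 ⌊(2 * x) ^ (1 / 2 : ℝ) / Real.log (2 * x) ^ B⌋₊,
        (⨆ b : (ZMod q)ˣ, |ParityWave0.chebyshevPsiMod q b (2 * x) - 2 * x / Nat.totient q|) ≤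
          C * (2 * x) / Real.log (2 * x) ^ A :=
      hBV2x (fun _ => 2 * x) fun _ => ⟨by linarith, le_rfl⟩
    have hlev1 : ⌊x ^ θ⌋₊ ≤ ⌊x ^ (1 / 2 : ℝ) / Real.log x ^ B⌋₊ := by
      rw [hθϖ]; exact Nat.floor_le_floor (MPZ.level_le (by linarith) hlox)
    have hlev2 : ⌊x ^ θ⌋₊ ≤ ⌊(2 * x) ^ (1 / 2 : ℝ) / Real.log (2 * x) ^ B⌋₊ := by
      rw [hθϖ]
      refine Nat.floor_le_floor (le_trans ?_ (MPZ.level_le (by linarith) hlo2x))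
      exact Real.rpow_le_rpow hx0.le (by linarith) (by linarith)
    have hF0 : ∀ (y z : ℝ) (q : ℕ),
        0 ≤ ⨆ b : (ZMod q)ˣ, |ParityWave0.chebyshevPsiMod q b y - z| :=
      fun y z q => Real.iSup_nonneg fun _ => abs_nonneg _
    have hterm : ∀ q ∈ S,
        |ParityWave0.chebyshevPsiMod q (a : ZMod q) (2 * x) -
            ParityWave0.chebyshevPsiMod q (a : ZMod q) x - x / Nat.totient q| ≤
          (⨆ b : (ZMod q)ˣ, |ParityWave0.chebyshevPsiMod q b (2 * x) - 2 * x / Nat.totient q|) +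
          (⨆ b : (ZMod q)ˣ, |ParityWave0.chebyshevPsiMod q b x - x / Nat.totient q|) := by
      intro q hq
      have hcop : IsCoprime a (q : ℤ) := (hS q hq).2.2
      have hsplit : ParityWave0.chebyshevPsiMod q (a : ZMod q) (2 * x) -
          ParityWave0.chebyshevPsiMod q (a : ZMod q) x - x / Nat.totient q =
          (ParityWave0.chebyshevPsiMod q (a : ZMod q) (2 * x) - 2 * x / Nat.totient q) -
          (ParityWave0.chebyshevPsiMod q (a : ZMod q) x - x / Nat.totient q) := by ring
      rw [hsplit]
      exact (abs_sub _ _).trans (add_le_add (MPZ.abs_sub_le_iSup hcop _ _)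
        (MPZ.abs_sub_le_iSup hcop _ _))
    have hlog2x : Real.log x ^ A ≤ Real.log (2 * x) ^ A :=
      Real.rpow_le_rpow hlogx.le (Real.log_le_log hx0 (by linarith)) hA
    calc ∑ q ∈ S, |ParityWave0.chebyshevPsiMod q (a : ZMod q) (2 * x) -
            ParityWave0.chebyshevPsiMod q (a : ZMod q) x - x / Nat.totient q|
        ≤ ∑ q ∈ S,
          ((⨆ b : (ZMod q)ˣ, |ParityWave0.chebyshevPsiMod q b (2 * x) - 2 * x / Nat.totient q|) +
          (⨆ b : (ZMod q)ˣ, |ParityWave0.chebyshevPsiMod q b x - x / Nat.totient q|)) :=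
          Finset.sum_le_sum hterm
      _ ≤ ∑ q ∈ Icc 1 ⌊x ^ θ⌋₊,
          ((⨆ b : (ZMod q)ˣ, |ParityWave0.chebyshevPsiMod q b (2 * x) - 2 * x / Nat.totient q|) +
          (⨆ b : (ZMod q)ˣ, |ParityWave0.chebyshevPsiMod q b x - x / Nat.totient q|)) :=
          Finset.sum_le_sum_of_subset_of_nonneg hSsub
            fun q _ _ => add_nonneg (hF0 _ _ q) (hF0 _ _ q)
      _ = ∑ q ∈ Icc 1 ⌊x ^ θ⌋₊,
            (⨆ b : (ZMod q)ˣ, |ParityWave0.chebyshevPsiMod q b (2 * x) - 2 * x / Nat.totient q|) +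
          ∑ q ∈ Icc 1 ⌊x ^ θ⌋₊,
            (⨆ b : (ZMod q)ˣ, |ParityWave0.chebyshevPsiMod q b x - x / Nat.totient q|) :=
          Finset.sum_add_distrib
      _ ≤ ∑ q ∈ Icc 1 ⌊(2 * x) ^ (1 / 2 : ℝ) / Real.log (2 * x) ^ B⌋₊,
            (⨆ b : (ZMod q)ˣ, |ParityWave0.chebyshevPsiMod q b (2 * x) - 2 * x / Nat.totient q|) +
          ∑ q ∈ Icc 1 ⌊x ^ (1 / 2 : ℝ) / Real.log x ^ B⌋₊,
            (⨆ b : (ZMod q)ˣ, |ParityWave0.chebyshevPsiMod q b x - x / Nat.totient q|) :=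
          add_le_add
            (Finset.sum_le_sum_of_subset_of_nonneg (Finset.Icc_subset_Icc le_rfl hlev2)
              fun q _ _ => hF0 _ _ q)
            (Finset.sum_le_sum_of_subset_of_nonneg (Finset.Icc_subset_Icc le_rfl hlev1)
              fun q _ _ => hF0 _ _ q)
      _ ≤ C * (2 * x) / Real.log (2 * x) ^ A + C * x / Real.log x ^ A := add_le_add h2 h1
      _ ≤ |C| * (2 * x) / Real.log (2 * x) ^ A + |C| * x / Real.log x ^ A :=
          add_le_add
            (div_le_div_of_nonneg_right (mul_le_mul_of_nonneg_right (le_abs_self C) (by linarith))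
              (hLA.le.trans hlog2x))
            (div_le_div_of_nonneg_right (mul_le_mul_of_nonneg_right (le_abs_self C) hx0.le) hLA.le)
      _ ≤ |C| * (2 * x) / Real.log x ^ A + |C| * x / Real.log x ^ A :=
          add_le_add (div_le_div_of_nonneg_left (mul_nonneg (abs_nonneg C) (by linarith))
            hLA hlog2x) le_rfl
      _ = 3 * |C| * x / Real.log x ^ A := by ring
      _ ≤ max (15 * x₁ * Real.log x₁ ^ A) (3 * |C|) * x / Real.log x ^ A :=
          div_le_div_of_nonneg_right (mul_le_mul_of_nonneg_right (le_max_right _ _) hx0.le) hLA.le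

/-- **`MPZ^{(i)}[ϖ, δ]` holds for every `ϖ < 0`, every `δ` and every `i`** — the Bombieri–Vinogradov
range of Claim 2.3, unconditionally from the tree's `bombieri_vinogradov_holds` (with level
`x^{1/2+2ϖ+ε}`, `ε = −max(ϖ, −1/4)`, inside `x^{1/2}(log x)^{-B}`), the coprime-mean main term being
interchangeable with `x/φ(q)` (`MPZ.sum_abs_mainTerm_sub_le`).  In particular the predicate `MPZi`
is inhabited non-trivially; every `ϖ ≥ 0` is Zhang–Polymath territory (Theorem 2.4).
[cite: Polymath8a2014, Claim 2.3][cite: Bombieri1965] -/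
theorem mpzi_of_neg (i : ℕ) {ϖ : ℝ} (hϖ : ϖ < 0) (δ : ℝ) : MPZi i ϖ δ := by
  -- reduce to `-1/4 ≤ ϖ`
  suffices hcore : ∀ ϖ : ℝ, ϖ < 0 → -1 / 4 ≤ ϖ → MPZi i ϖ δ from
    (hcore (max ϖ (-1 / 4)) (max_lt hϖ (by norm_num)) (le_max_right _ _)).mono (le_max_left _ _)
  intro ϖ hϖ hϖ1 A
  -- the level `x^{1/2+2ϖ+ε}` with `ε = -ϖ`, i.e. `θ = 1/2 + ϖ = 1/2 + 2(ϖ/2)`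
  set A' : ℝ := max A 0 with hA'
  obtain ⟨C, hC⟩ := MPZi.sum_abs_sub_le_of_bombieri_vinogradov bombieri_vinogradov_holds
    (θ := 1 / 2 + ϖ) (by linarith) (by linarith) (le_max_right A 0)
  obtain ⟨K, hK⟩ := MPZ.sum_abs_mainTerm_sub_le (ϖ := ϖ / 2) (by linarith) A
  set κ : ℝ := Real.log 2 ^ (A - A') with hκ
  have hκ0 : 0 < κ := Real.rpow_pos_of_pos (Real.log_pos one_lt_two) _
  refine ⟨-ϖ, by linarith, max C 0 * κ + K, fun x hx I hI a ha S hS => ?_⟩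
  have hx0 : 0 < x := by linarith
  have hlogx : 0 < Real.log x := Real.log_pos (by linarith)
  have hLA : 0 < Real.log x ^ A := Real.rpow_pos_of_pos hlogx A
  have hLA' : 0 < Real.log x ^ A' := Real.rpow_pos_of_pos hlogx A'
  have hexp : (1 : ℝ) / 2 + 2 * ϖ + -ϖ = 1 / 2 + ϖ := by ring
  -- the `x/φ(q)` form over `S`, with exponent `A'`, then `A`
  have hS' : ∀ q ∈ S, q ≠ 0 ∧ (q : ℝ) ≤ x ^ (1 / 2 + ϖ) ∧ IsCoprime a (q : ℤ) := fun q hq => by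
    obtain ⟨h1, h2, h3, -⟩ := hS q hq
    rw [hexp] at h1
    exact ⟨h2.ne_zero, h1, MPZi.isCoprime_of_primeFactors_subset h2.ne_zero ha h3⟩
  have hV : ∑ q ∈ S, |ParityWave0.chebyshevPsiMod q (a : ZMod q) (2 * x) -
      ParityWave0.chebyshevPsiMod q (a : ZMod q) x - x / Nat.totient q| ≤
      max C 0 * κ * x / Real.log x ^ A := by
    refine (hC x hx a S hS').trans ?_
    have hcmp : Real.log x ^ A ≤ κ * Real.log x ^ A' :=
      MPZ.log_rpow_le_mul_log_rpow hx (le_max_left A 0)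
    rw [div_le_div_iff₀ hLA' hLA]
    calc C * x * Real.log x ^ A ≤ max C 0 * x * Real.log x ^ A :=
        mul_le_mul_of_nonneg_right (mul_le_mul_of_nonneg_right (le_max_left _ _) hx0.le) hLA.le
      _ ≤ max C 0 * x * (κ * Real.log x ^ A') :=
        mul_le_mul_of_nonneg_left hcmp (mul_nonneg (le_max_right _ _) hx0.le)
      _ = max C 0 * κ * x * Real.log x ^ A' := by ring
  -- the main-term correction over `S ⊆ [1, x^{1/2 + 2(ϖ/2)}]`
  have hSsub : S ⊆ Finset.Icc 1 ⌊x ^ (1 / 2 + 2 * (ϖ / 2))⌋₊ := fun q hq => by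
    obtain ⟨h0, h1, -⟩ := hS' q hq
    refine Finset.mem_Icc.mpr ⟨Nat.one_le_iff_ne_zero.mpr h0, Nat.le_floor ?_⟩
    have : (1 : ℝ) / 2 + 2 * (ϖ / 2) = 1 / 2 + ϖ := by ring
    rw [this]; exact h1
  have hE : ∑ q ∈ S,
      |((∑ n ∈ range (⌊2 * x⌋₊ + 1) with n.Coprime q, Λ n) -
          ∑ n ∈ range (⌊x⌋₊ + 1) with n.Coprime q, Λ n) / Nat.totient q - x / Nat.totient q| ≤
      K * x / Real.log x ^ A :=
    (Finset.sum_le_sum_of_subset_of_nonneg hSsub fun q _ _ => abs_nonneg _).trans (hK x hx)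
  -- triangle inequality
  calc ∑ q ∈ S, |ParityWave0.chebyshevPsiMod q (a : ZMod q) (2 * x) -
          ParityWave0.chebyshevPsiMod q (a : ZMod q) x -
          ((∑ n ∈ range (⌊2 * x⌋₊ + 1) with n.Coprime q, Λ n) -
            ∑ n ∈ range (⌊x⌋₊ + 1) with n.Coprime q, Λ n) / Nat.totient q|
      ≤ ∑ q ∈ S, (|ParityWave0.chebyshevPsiMod q (a : ZMod q) (2 * x) -
            ParityWave0.chebyshevPsiMod q (a : ZMod q) x - x / Nat.totient q| +
          |((∑ n ∈ range (⌊2 * x⌋₊ + 1) with n.Coprime q, Λ n) -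
            ∑ n ∈ range (⌊x⌋₊ + 1) with n.Coprime q, Λ n) / Nat.totient q - x / Nat.totient q|) := by
        refine Finset.sum_le_sum fun q _ => ?_
        refine le_trans (le_of_eq ?_) (abs_sub _ _)
        congr 1; ring
    _ ≤ max C 0 * κ * x / Real.log x ^ A + K * x / Real.log x ^ A := by
        rw [Finset.sum_add_distrib]; exact add_le_add hV hE
    _ = (max C 0 * κ + K) * x / Real.log x ^ A := by ring

end Literature.NumberTheory.Sieve
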